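import Mathlib.Dynamics.Ergodic.Action.Regular
import Mathlib.MeasureTheory.Measure.Haar.Basic
import Mathlib.MeasureTheory.Function.L2Space
import Mathlib.Order.Filter.CountableSeparatingOn
import Literature.NumberTheory.Automorphic.AutomorphicSpectrumProofs
import Literature.NumberTheory.Automorphic.HilbertRepSpectrumProofs
import HarnessLib

/-!
# Ergodicity of `G(𝔸_K)` on the automorphic quotient; one-dimensional constituents of `L²`

Topic `NumberTheory/Automorphic`; theorems only (no definition, no instance, no named fact).

For an adelic group datum `𝒢` over a number field `K` whose adelic group `G(𝔸_K)` is locally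
compact and second countable, and an automorphic measure `μ` on the automorphic quotient
`X = G(𝔸_K) ⧸ (A_G · G(K))` (`AdelicGroupData.IsAutomorphicMeasure`: finite, inner regular,
positive on opens, `G(𝔸_K)`-invariant), we prove:

* `ergodicSMul_of_isPretransitive` — **a transitive continuous action of a locally compact second
  countable group `G` on a Borel space `X` is ergodic for every s-finite invariant measure `μ`**
  (a measurable `s ⊆ X` with `g⁻¹ s = s` a.e. for every `g` is null or conull). Proof (Fubini,
  as for the regular action of `G` on itself, which is Mathlib's `ErgodicSMul G G ν`): for a
  left Haar measure `ν` on `G` and the orbit map `Θ(g) = g • x₀`, Tonelli and the invariance of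
  `μ` give `∫ ν{g | g • x ∈ A} dμ(x) = μ(A) ν(G)` (`lintegral_measure_preimage_smul`), whence,
  using transitivity and the right quasi-invariance of `ν` (Mathlib `measure_mul_right_null`),
  `μ(A) = 0 ↔ ν(Θ⁻¹ A) = 0`; so `Θ⁻¹ s` is a.e. invariant under left translations, hence
  `ν`-null or conull, hence `s` is `μ`-null or conull. (Zimmer, *Ergodic theory and semisimple
  groups* (1984), §2.2; Bekka–de la Harpe–Valette, *Kazhdan's property (T)*, App. A.)
* `ae_eq_const_of_forall_smul_ae_eq` — under an ergodic action, an a.e. strongly measurable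
  function invariant a.e. under each `g` is a.e. constant (the group-action analogue of Mathlib's
  `QuasiErgodic.ae_eq_const_of_ae_eq_comp_ae`, same proof).
* `AdelicGroupData.ergodicSMul_automorphicQuotient` — the case `G = G(𝔸_K)`, `X` the automorphic
  quotient, `μ` automorphic; `AdelicGroupData.ae_eq_const_of_rightRegular_apply_eq` — an `L²`
  function fixed by the regular representation is a.e. constant.
* `AdelicGroupData.inner_coeFn_ae_eq_const` — for two `χ`-eigenfunctions `a, b ∈ L²(X, μ)` of the
  regular representation `R` (`R(g) a = χ(g) a`, `R(g) b = χ(g) b`, one function `χ`), the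
  integrable function `x ↦ ⟪a x, b x⟫` is `G(𝔸_K)`-invariant, hence a.e. equal to the constant
  `⟪a, b⟫ / μ(X)`; so (`AdelicGroupData.eq_zero_of_inner_eq_zero_of_rightRegular_apply_eq_smul`)
  **a `χ`-eigenfunction orthogonal to a non-zero `χ`-eigenfunction vanishes** (`|a|²` is a.e. a
  non-zero constant while `ā b` vanishes a.e.).
* `AdelicGroupData.closedSubrep_eq_of_finrank_eq_one` — **one-dimensional automorphic
  representations occur in `L²(G(𝔸_K) ⧸ A_G G(K))` with multiplicity one**: two closed invariant
  subspaces of `L²`, the first irreducible and one-dimensional, which are unitarily equivalent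
  (indeed merely equivalent) coincide. (The lines are spanned by eigenfunctions `a`, `b = e(a)`
  for one function `χ`; the component of `b` orthogonal to `a` is a `χ`-eigenfunction orthogonal
  to `a ≠ 0`, hence `0`, so `b ∈ ℂ a`.) This is the part "(most of)" of Gelbart's proof of
  multiplicity one for quaternion algebras (Gelbart (1975), Thm. 10.10, p. 158), where the
  one-dimensional constituents `g ↦ χ(nrd g)` fall outside the Jacquet–Langlands correspondence;
  it is used for `𝒢 = AdelicGroupData.units K D` in `JacquetLanglandsMultiplicityOneProofs`.

## Design notes

* The abstract theorems are stated for any topological group `G` acting continuously and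
  transitively (`MulAction.IsPretransitive`) on a Borel space, Mathlib generality; `G` is
  equipped with its Borel σ-algebra only inside the proofs (`borelize`), as the tree does for
  `𝒢.Adelic` (`AutomorphicSpectrumProofs`). Local compactness gives the Haar measure, second
  countability gives `σ`-finiteness of Haar measure and the measurability of `(g, x) ↦ g • x` for
  the product of the Borel σ-algebras (Mathlib `ContinuousSMul.measurableSMul₂`).
* `ErgodicSMul` is produced as a theorem, never as an instance.
* Nothing is specific to quaternion algebras or to `GL_n`; the instantiations supply
  `LocallyCompactSpace`/`SecondCountableTopology` of `G(𝔸_K)` (in the tree for `GL_n(𝔸_K)`: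
  `GLnAdelicLocallyCompact`, `AdelicSecondCountable`).

## References

* R. J. Zimmer, *Ergodic theory and semisimple groups*, Monographs in Math. 81 (1984), §2.2
  (ergodicity of actions on homogeneous spaces `G/H`).
* B. Bekka, P. de la Harpe, A. Valette, *Kazhdan's property (T)* (2008), Appendix A
  (quasi-invariant measures on homogeneous spaces).
* S. Gelbart, *Automorphic forms on adele groups*, Ann. of Math. Studies 83 (1975), Thm. 10.10,
  p. 158 [Gelbart1975].
* G. B. Folland, *A course in abstract harmonic analysis* (1995), §2.6, §3.1 [Folland1995].
-/

noncomputable section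

open MeasureTheory Filter Set Topology
open scoped ENNReal InnerProductSpace ComplexConjugate

/-! ### Equivalent representations have the same dimension -/

namespace ContRepresentation

section Finrank

variable {R G V V' : Type*} [Ring R] [Monoid G] [SeminormedAddCommGroup V] [Module R V]
  [SeminormedAddCommGroup V'] [Module R V']

/-- Unitarily equivalent representations have the same dimension (`Module.finrank`, with its
junk value `0` in infinite dimension on both sides): the equivalence is in particular a linear
isomorphism (Mathlib `LinearEquiv.finrank_eq`). Deliberate dot-notation extension of
`ContRepresentation.AreUnitarilyEquivalent` (`HilbertRepSpectrum`). [folklore] -/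
theorem AreUnitarilyEquivalent.finrank_eq {π : ContRepresentation R G V}
    {σ : ContRepresentation R G V'} (h : AreUnitarilyEquivalent π σ) :
    Module.finrank R V = Module.finrank R V' := by
  obtain ⟨e, -⟩ := h
  exact LinearEquiv.finrank_eq e.toContinuousLinearEquiv.toLinearEquiv

end Finrank

end ContRepresentation

namespace Literature.NumberTheory.Automorphic

/-! ### Transitive actions of locally compact groups are ergodic -/

section Transitive

variable {G X : Type*} [Group G] [TopologicalSpace G] [IsTopologicalGroup G]
  [SecondCountableTopology G] [MulAction G X] [TopologicalSpace X] [MeasurableSpace X]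
  [BorelSpace X] [ContinuousSMul G X]

omit [IsTopologicalGroup G] in
/-- **Tonelli for an invariant measure.** For a `G`-invariant s-finite measure `μ` on `X`, any
s-finite measure `ν` on `G` and a measurable `A ⊆ X`:
`∫⁻ x, ν {g | g • x ∈ A} ∂μ = μ A * ν G` — both sides are the `μ ⊗ ν`-measure of
`{(x, g) | g • x ∈ A}`, computed fibrewise in the two orders (Zimmer (1984), §2.2). [folklore] -/
theorem lintegral_measure_preimage_smul [MeasurableSpace G] [BorelSpace G] (μ : Measure X)
    [SFinite μ] [SMulInvariantMeasure G X μ] (ν : Measure G) [SFinite ν] {A : Set X}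
    (hA : MeasurableSet A) :
    ∫⁻ x, ν ((· • x) ⁻¹' A) ∂μ = μ A * ν univ := by
  have hmeas : Measurable fun p : X × G => p.2 • p.1 := measurable_snd.smul measurable_fst
  have hind : Measurable (A.indicator (1 : X → ℝ≥0∞)) := measurable_one.indicator hA
  calc ∫⁻ x, ν ((· • x) ⁻¹' A) ∂μ
      = ∫⁻ x, ∫⁻ g, A.indicator 1 (g • x) ∂ν ∂μ := by
        refine lintegral_congr fun x => ?_
        have hx : MeasurableSet ((fun g : G => g • x) ⁻¹' A) :=
          measurableSet_preimage (measurable_id.smul_const x) hA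
        exact (lintegral_indicator_one hx).symm
    _ = ∫⁻ g, ∫⁻ x, A.indicator 1 (g • x) ∂μ ∂ν :=
        lintegral_lintegral_swap (hind.comp hmeas).aemeasurable
    _ = ∫⁻ _g, μ A ∂ν := by
        refine lintegral_congr fun g => ?_
        have h := lintegral_indicator_one (μ := μ)
          (measurableSet_preimage (measurable_const_smul g) hA)
        rw [SMulInvariantMeasure.measure_preimage_smul g hA] at h
        rw [← h]
        rfl
    _ = μ A * ν univ := by rw [lintegral_const]

variable [LocallyCompactSpace G] [MulAction.IsPretransitive G X]

/-- **A transitive continuous action of a locally compact second countable group on a Borel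
space is ergodic for every invariant s-finite measure** (Zimmer, *Ergodic theory and semisimple
groups* (1984), §2.2; the homogeneous space `G/H` with its invariant measure class). If a
measurable `s ⊆ X` satisfies `g⁻¹ s = s` a.e. for every `g ∈ G`, then `s` is null or conull.
Proof: let `ν` be a left Haar measure on `G` and `Θ(g) = g • x₀` an orbit map. By
`lintegral_measure_preimage_smul`, transitivity and the right quasi-invariance of `ν` (Mathlib
`measure_mul_right_null`), `μ A = 0 ↔ ν (Θ⁻¹ A) = 0` for measurable `A`. Hence `Θ⁻¹ s` is
a.e. invariant under all left translations, so it is `ν`-null or conull by the ergodicity of `G`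
on itself (Mathlib `ErgodicSMul G G ν`), and accordingly `s` is `μ`-null or conull. [folklore] -/
theorem ergodicSMul_of_isPretransitive (μ : Measure X) [SFinite μ] [SMulInvariantMeasure G X μ] :
    ErgodicSMul G X μ := by
  borelize G
  refine ⟨fun {s} hs hinv => ?_⟩
  rcases eq_zero_or_neZero μ with rfl | hμ
  · rw [eventuallyConst_set, ae_zero]
    exact Or.inl eventually_bot
  set ν : Measure G := Measure.haar with hν
  obtain ⟨x₀, -⟩ : (univ : Set X).Nonempty :=
    nonempty_of_measure_ne_zero (Measure.measure_univ_ne_zero.2 hμ.ne)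
  set Θ : G → X := fun g => g • x₀ with hΘ
  have hΘm : Measurable Θ := (continuous_id.smul continuous_const).measurable
  -- every orbit map is a right translate of `Θ`
  have horbit : ∀ x : X, ∃ k : G, ∀ A : Set X,
      (fun g : G => g • x) ⁻¹' A = (· * k) ⁻¹' (Θ ⁻¹' A) := by
    intro x
    obtain ⟨k, hk⟩ := MulAction.exists_smul_eq G x₀ x
    refine ⟨k, fun A => ?_⟩
    ext g
    simp only [mem_preimage, hΘ, ← hk, mul_smul]
  -- (1) `μ`-null sets have `ν`-null orbit preimages
  have L1 : ∀ A : Set X, MeasurableSet A → μ A = 0 → ν (Θ ⁻¹' A) = 0 := by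
    intro A hA hA0
    have h := lintegral_measure_preimage_smul μ ν hA
    rw [hA0, zero_mul] at h
    have hmE : MeasurableSet ((fun p : X × G => p.2 • p.1) ⁻¹' A) :=
      measurableSet_preimage (measurable_snd.smul measurable_fst) hA
    have hae : ∀ᵐ x ∂μ, ν ((· • x) ⁻¹' A) = 0 :=
      (lintegral_eq_zero_iff (measurable_measure_prodMk_left hmE)).1 h
    obtain ⟨x₁, hx₁⟩ := hae.exists
    obtain ⟨k, hk⟩ := MulAction.exists_smul_eq G x₁ x₀
    have hpre : Θ ⁻¹' A = (· * k) ⁻¹' ((· • x₁) ⁻¹' A) := by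
      ext g
      simp only [mem_preimage, hΘ, ← hk, mul_smul]
    rw [hpre, measure_mul_right_null]
    exact hx₁
  -- (2) conversely, `ν`-null orbit preimages come from `μ`-null sets
  have L2 : ∀ A : Set X, MeasurableSet A → ν (Θ ⁻¹' A) = 0 → μ A = 0 := by
    intro A hA hA0
    have hall : ∀ x : X, ν ((· • x) ⁻¹' A) = 0 := by
      intro x
      obtain ⟨k, hk⟩ := horbit x
      rw [hk A, measure_mul_right_null]
      exact hA0
    have h := lintegral_measure_preimage_smul μ ν hA
    simp_rw [hall, lintegral_zero] at h
    have hν : ν univ ≠ 0 := isOpen_univ.measure_ne_zero ν univ_nonempty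
    exact (mul_eq_zero.1 h.symm).resolve_right hν
  -- (3) `Θ⁻¹ s` is a.e. invariant under left translations, hence `ν`-null or conull
  have hS : MeasurableSet (Θ ⁻¹' s) := hΘm hs
  have hSinv : ∀ g : G, (g • ·) ⁻¹' (Θ ⁻¹' s) =ᵐ[ν] Θ ⁻¹' s := by
    intro g
    have h1 : (g • ·) ⁻¹' (Θ ⁻¹' s) = Θ ⁻¹' ((g • ·) ⁻¹' s) := by
      ext k
      simp only [mem_preimage, hΘ, smul_eq_mul, mul_smul]
    rw [h1]
    have h2 := hinv g
    have hgs : MeasurableSet ((g • ·) ⁻¹' s) :=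
      measurableSet_preimage (measurable_const_smul g) hs
    rw [ae_eq_set] at h2 ⊢
    refine ⟨?_, ?_⟩
    · rw [← preimage_sdiff]
      exact L1 _ (hgs.diff hs) h2.1
    · rw [← preimage_sdiff]
      exact L1 _ (hs.diff hgs) h2.2
  have hconst : EventuallyConst (Θ ⁻¹' s) (ae ν) :=
    aeconst_of_forall_preimage_smul_ae_eq G hS.nullMeasurableSet hSinv
  -- (4) back to `s`
  rw [eventuallyConst_set] at hconst ⊢
  rcases hconst with h | h
  · left
    have h' : ν (Θ ⁻¹' sᶜ) = 0 := by
      rw [preimage_compl]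
      exact mem_ae_iff.1 (eventually_mem_set.1 h)
    exact eventually_mem_set.2 (mem_ae_iff.2 (L2 _ hs.compl h'))
  · right
    have h' : ν (Θ ⁻¹' s) = 0 := by
      have := ae_iff.1 h
      simpa only [not_not, setOf_mem_eq] using this
    refine ae_iff.2 ?_
    simpa only [not_not, setOf_mem_eq] using L2 _ hs h'

end Transitive

/-! ### Invariant functions under an ergodic action are a.e. constant -/

section Functions

variable {G X E : Type*} [SMul G X] [MeasurableSpace X] {μ : Measure X} [ErgodicSMul G X μ]
  [TopologicalSpace E] [TopologicalSpace.MetrizableSpace E] [Nonempty E]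

/-- Under an ergodic action of `G` on `(X, μ)`, an a.e. strongly measurable function `f` with
`f (g • x) = f x` a.e. for every `g ∈ G` is a.e. equal to a constant: each sublevel set
`f⁻¹ U` is a.e. invariant, hence null or conull, and a function all of whose preimages of
measurable sets are null or conull is a.e. constant on a space with countably many separating
measurable sets (Mathlib `exists_eventuallyEq_const_of_eventually_mem_of_forall_separating`;
the group-action analogue of Mathlib's `QuasiErgodic.ae_eq_const_of_ae_eq_comp_ae`).
[folklore] -/
theorem ae_eq_const_of_forall_smul_ae_eq {f : X → E} (hfm : AEStronglyMeasurable f μ)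
    (hf : ∀ g : G, (fun x => f (g • x)) =ᵐ[μ] f) : ∃ c : E, f =ᵐ[μ] Function.const X c := by
  borelize E
  rcases hfm.isSeparable_ae_range with ⟨t, ht, hft⟩
  haveI := ht.secondCountableTopology
  refine exists_eventuallyEq_const_of_eventually_mem_of_forall_separating MeasurableSet hft ?_
  intro U hU
  have hc : EventuallyConst (f ⁻¹' U) (ae μ) :=
    aeconst_of_forall_preimage_smul_ae_eq G (hfm.aemeasurable.nullMeasurable hU)
      fun g => (hf g).preimage U
  exact eventuallyConst_set.1 hc

end Functions

/-! ### The automorphic quotient -/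

namespace AdelicGroupData

universe u

variable {K : Type} [Field K] [NumberField K] (𝒢 : AdelicGroupData.{u} K)
  [LocallyCompactSpace 𝒢.Adelic] [SecondCountableTopology 𝒢.Adelic]
  (μ : Measure 𝒢.automorphicQuotient) [𝒢.IsAutomorphicMeasure μ]

/-- **`G(𝔸_K)` acts ergodically on the automorphic quotient `G(𝔸_K) ⧸ (A_G · G(K))`** with
respect to any automorphic measure (finite and invariant suffices), for `G(𝔸_K)` locally
compact and second countable: the action is transitive (Mathlib
`MulAction.isPretransitive_quotient`) and continuous, so `ergodicSMul_of_isPretransitive`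
applies (Zimmer (1984), §2.2). [folklore] -/
theorem ergodicSMul_automorphicQuotient : ErgodicSMul 𝒢.Adelic 𝒢.automorphicQuotient μ := by
  haveI : MulAction.IsPretransitive 𝒢.Adelic 𝒢.automorphicQuotient :=
    inferInstanceAs (MulAction.IsPretransitive 𝒢.Adelic (𝒢.Adelic ⧸ 𝒢.quotientSubgroup))
  exact ergodicSMul_of_isPretransitive μ

omit [LocallyCompactSpace 𝒢.Adelic] [SecondCountableTopology 𝒢.Adelic] in
/-- An automorphic measure has non-zero (and finite) total mass: the automorphic quotient is
non-empty and `μ` is positive on non-empty open sets. [folklore] -/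
theorem measureReal_univ_ne_zero : μ.real univ ≠ 0 := by
  rw [measureReal_def, ENNReal.toReal_ne_zero]
  exact ⟨isOpen_univ.measure_ne_zero μ ⟨𝒢.toAutomorphicQuotient 1, trivial⟩,
    measure_ne_top μ univ⟩

/-- **An `L²` function on the automorphic quotient fixed by the regular representation is a.e.
constant**: if `R(g) f = f` for every `g ∈ G(𝔸_K)` then `f = c` a.e. (ergodicity,
`ergodicSMul_automorphicQuotient`, applied to the a.e. identities `f (g⁻¹ • x) = f x`).
[folklore] -/
theorem ae_eq_const_of_rightRegular_apply_eq {f : 𝒢.L2 μ}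
    (hf : ∀ g : 𝒢.Adelic, 𝒢.rightRegular μ g f = f) :
    ∃ c : ℂ, (f : 𝒢.automorphicQuotient → ℂ) =ᵐ[μ] Function.const _ c := by
  haveI := 𝒢.ergodicSMul_automorphicQuotient μ
  refine ae_eq_const_of_forall_smul_ae_eq (G := 𝒢.Adelic) (Lp.aestronglyMeasurable f)
    fun g => ?_
  have h := 𝒢.rightRegular_apply_coeFn μ g⁻¹ f
  rw [hf g⁻¹, inv_inv] at h
  exact h.symm

omit [LocallyCompactSpace 𝒢.Adelic] [SecondCountableTopology 𝒢.Adelic] in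
/-- The a.e. form of an eigen-identity `R(g) f = χ(g) f` in `L²` of the automorphic quotient:
`f (g • x) = χ(g⁻¹) f x` for a.e. `x` (`rightRegular_apply_coeFn`). [folklore] -/
theorem coeFn_smul_ae_eq_of_rightRegular_apply_eq_smul {f : 𝒢.L2 μ} {χ : 𝒢.Adelic → ℂ}
    (hf : ∀ g, 𝒢.rightRegular μ g f = χ g • f) (g : 𝒢.Adelic) :
    ∀ᵐ x ∂μ, (f : 𝒢.automorphicQuotient → ℂ) (g • x) = χ g⁻¹ * f x := by
  have h1 := 𝒢.rightRegular_apply_coeFn μ g⁻¹ f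
  rw [hf g⁻¹, inv_inv] at h1
  filter_upwards [h1, Lp.coeFn_smul (χ g⁻¹) f] with x hx hx'
  rw [← hx, hx', Pi.smul_apply, smul_eq_mul]

/-- **Products of eigenfunctions with the same character are a.e. constant.** Let
`a, b ∈ L²(G(𝔸_K) ⧸ A_G G(K), μ)` satisfy `R(g) a = χ(g) a` and `R(g) b = χ(g) b` for every
`g`, for one function `χ : G(𝔸_K) → ℂ`, with `a ≠ 0` (so that `|χ(g)| = 1`, `R` being
isometric). Then `x ↦ ⟪a x, b x⟫` is an invariant integrable function, hence a.e. equal to the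
constant `⟪a, b⟫ / μ(X)` (ergodicity; `∫ ⟪a x, b x⟫ dμ = ⟪a, b⟫`, Mathlib `L2.inner_def`).
[folklore] -/
theorem inner_coeFn_ae_eq_const {a b : 𝒢.L2 μ} {χ : 𝒢.Adelic → ℂ}
    (ha : ∀ g, 𝒢.rightRegular μ g a = χ g • a) (hb : ∀ g, 𝒢.rightRegular μ g b = χ g • b)
    (ha0 : a ≠ 0) :
    (fun x => ⟪(a : 𝒢.automorphicQuotient → ℂ) x, (b : 𝒢.automorphicQuotient → ℂ) x⟫_ℂ) =ᵐ[μ]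
      Function.const _ ((μ.real univ)⁻¹ • ⟪a, b⟫_ℂ) := by
  haveI := 𝒢.ergodicSMul_automorphicQuotient μ
  -- `|χ g| = 1`
  have hχ : ∀ g, ‖χ g‖ = 1 := by
    intro g
    have h := 𝒢.norm_rightRegular_apply μ g a
    rw [ha g, norm_smul] at h
    exact (mul_eq_right₀ (norm_ne_zero_iff.2 ha0)).1 h
  set F : 𝒢.automorphicQuotient → ℂ := fun x =>
    ⟪(a : 𝒢.automorphicQuotient → ℂ) x, (b : 𝒢.automorphicQuotient → ℂ) x⟫_ℂ with hF
  have hFm : AEStronglyMeasurable F μ :=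
    (Lp.aestronglyMeasurable a).inner (Lp.aestronglyMeasurable b)
  have hFinv : ∀ g : 𝒢.Adelic, (fun x => F (g • x)) =ᵐ[μ] F := by
    intro g
    filter_upwards [𝒢.coeFn_smul_ae_eq_of_rightRegular_apply_eq_smul μ ha g,
      𝒢.coeFn_smul_ae_eq_of_rightRegular_apply_eq_smul μ hb g] with x hxa hxb
    simp only [hF, hxa, hxb]
    rw [← smul_eq_mul, ← smul_eq_mul, inner_smul_left, inner_smul_right, ← mul_assoc,
      RCLike.conj_mul, hχ]
    simp
  obtain ⟨c, hc⟩ := ae_eq_const_of_forall_smul_ae_eq (G := 𝒢.Adelic) hFm hFinv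
  -- identify the constant by integrating
  have hint : ∫ x, F x ∂μ = ⟪a, b⟫_ℂ := (L2.inner_def a b).symm
  have hint' : ∫ x, F x ∂μ = (μ.real univ) • c := by
    rw [integral_congr_ae hc]
    exact integral_const c
  have hc' : c = (μ.real univ)⁻¹ • ⟪a, b⟫_ℂ := by
    rw [← hint, hint', smul_smul, inv_mul_cancel₀ (𝒢.measureReal_univ_ne_zero μ), one_smul]
  rw [← hc']
  exact hc

/-- **A `χ`-eigenfunction orthogonal to a non-zero `χ`-eigenfunction vanishes.** With `a, b, χ`
as in `inner_coeFn_ae_eq_const`, `a ≠ 0` and `⟪a, b⟫ = 0`: the invariant functions `ā b` and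
`|a|²` are a.e. the constants `0` and `‖a‖² / μ(X) ≠ 0`, so `a ≠ 0` a.e. and `b = 0` a.e.
(the ergodicity argument behind "the one-dimensional constituents occur once"). [folklore] -/
theorem eq_zero_of_inner_eq_zero_of_rightRegular_apply_eq_smul {a b : 𝒢.L2 μ}
    {χ : 𝒢.Adelic → ℂ} (ha : ∀ g, 𝒢.rightRegular μ g a = χ g • a)
    (hb : ∀ g, 𝒢.rightRegular μ g b = χ g • b) (ha0 : a ≠ 0) (hab : ⟪a, b⟫_ℂ = 0) :
    b = 0 := by
  have h1 := 𝒢.inner_coeFn_ae_eq_const μ ha hb ha0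
  have h2 := 𝒢.inner_coeFn_ae_eq_const μ ha ha ha0
  rw [hab, smul_zero] at h1
  have hc : (μ.real univ)⁻¹ • ⟪a, a⟫_ℂ ≠ 0 :=
    smul_ne_zero (inv_ne_zero (𝒢.measureReal_univ_ne_zero μ)) (inner_self_ne_zero.2 ha0)
  refine Lp.eq_zero_iff_ae_eq_zero.2 ?_
  filter_upwards [h1, h2] with x hx1 hx2
  simp only [Function.const_apply] at hx1 hx2
  have hax : (a : 𝒢.automorphicQuotient → ℂ) x ≠ 0 := by
    intro h0
    apply hc
    rw [← hx2]
    simp [h0]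
  rw [RCLike.inner_apply, mul_eq_zero] at hx1
  rcases hx1 with h | h
  · exact h
  · exact absurd ((map_eq_zero _).1 h) hax

/-- **One-dimensional automorphic representations occur in `L²(G(𝔸_K) ⧸ A_G G(K))` with
multiplicity one** (the case "(most of)" left aside in Gelbart's proof of multiplicity one for
`D^×`, Gelbart (1975), Thm. 10.10, p. 158). Let `W₁, W₂` be closed invariant subspaces of `L²`
with `W₁` topologically irreducible and one-dimensional, and suppose the representations on
`W₁` and `W₂` are unitarily equivalent. Then `W₁ = W₂`. Proof: `W₁ = ℂ a` with
`R(g) a = χ(g) a`; for an equivalence `e`, `b = e(a)` spans the line `W₂` (equivalences preserve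
`finrank`) and `R(g) b = χ(g) b` with the same `χ`; the component `b - (⟪a,b⟫/⟪a,a⟫) a` of `b`
orthogonal to `a` is again a `χ`-eigenfunction, hence `0`
(`eq_zero_of_inner_eq_zero_of_rightRegular_apply_eq_smul`), so `b ∈ W₁`, `W₂ ≤ W₁`, and
`W₂ = W₁` by irreducibility. [folklore] -/
theorem closedSubrep_eq_of_finrank_eq_one
    {W₁ W₂ : ContRepresentation.ClosedSubrep (𝒢.rightRegular μ)}
    (h₁ : W₁.toContRep.IsTopIrreducible) (hdim : Module.finrank ℂ W₁.toSubmodule = 1)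
    (he : ContRepresentation.AreUnitarilyEquivalent W₁.toContRep W₂.toContRep) : W₁ = W₂ := by
  obtain ⟨e, -⟩ := id he
  -- a generator of the line `W₁` and its eigencharacter
  obtain ⟨v, hv0, hv⟩ := finrank_eq_one_iff'.1 hdim
  have hχex : ∀ g : 𝒢.Adelic, ∃ c : ℂ, c • v = W₁.toContRep g v := fun g => hv _
  choose χ hχ using hχex
  set a : 𝒢.L2 μ := (v : 𝒢.L2 μ) with ha_def
  set b : 𝒢.L2 μ := ((e v : W₂.toSubmodule) : 𝒢.L2 μ) with hb_def
  have ha : ∀ g, 𝒢.rightRegular μ g a = χ g • a := fun g =>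
    (congrArg Subtype.val (hχ g)).symm
  have hb : ∀ g, 𝒢.rightRegular μ g b = χ g • b := by
    intro g
    have h1 : e (W₁.toContRep g v) = W₂.toContRep g (e v) :=
      e.toContIntertwiningMap.isIntertwining g v
    rw [← hχ g, map_smul] at h1
    exact (congrArg Subtype.val h1).symm
  have ha0 : a ≠ 0 := fun h => hv0 (Subtype.ext h)
  -- the component of `b` orthogonal to `a` vanishes
  set c₀ : ℂ := ⟪a, b⟫_ℂ / ⟪a, a⟫_ℂ with hc₀
  have hh : ∀ g, 𝒢.rightRegular μ g (b - c₀ • a) = χ g • (b - c₀ • a) := by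
    intro g
    rw [map_sub, map_smul, ha g, hb g, smul_sub, smul_comm]
  have horth : ⟪a, b - c₀ • a⟫_ℂ = 0 := by
    rw [inner_sub_right, inner_smul_right, hc₀, div_mul_cancel₀ _ (inner_self_ne_zero.2 ha0),
      sub_self]
  have h0 : b - c₀ • a = 0 :=
    𝒢.eq_zero_of_inner_eq_zero_of_rightRegular_apply_eq_smul μ ha hh ha0 horth
  have hb_mem : b ∈ W₁ := by
    rw [sub_eq_zero] at h0
    rw [h0]
    exact W₁.toSubmodule.smul_mem c₀ v.2
  -- `W₂` is the line through `b`, hence contained in `W₁`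
  have hb0 : b ≠ 0 := by
    intro hb0
    apply hv0
    have h : e v = 0 := Subtype.ext hb0
    simpa using congrArg e.symm h
  have hdim₂ : Module.finrank ℂ W₂.toSubmodule = 1 := by
    rw [← he.finrank_eq]
    exact hdim
  have hle : W₂ ≤ W₁ := by
    intro w hw
    obtain ⟨c, hc⟩ := (finrank_eq_one_iff_of_nonzero' (e v) (fun h => hb0
      (congrArg Subtype.val h))).1 hdim₂ ⟨w, hw⟩
    have hw' : w = c • b := (congrArg Subtype.val hc).symm
    rw [hw']
    exact W₁.toSubmodule.smul_mem c hb_mem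
  have hnt : Nontrivial W₂.toSubmodule := ⟨⟨⟨b, (e v).2⟩, 0, fun h => hb0 (congrArg Subtype.val h)⟩⟩
  exact (ContRepresentation.ClosedSubrep.eq_of_le_of_isTopIrreducible h₁ hnt hle).symm

end AdelicGroupData

end Literature.NumberTheory.Automorphic
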